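import Mathlib
import Summits.NavierStokesRegularity.NavierStokesRegularity.Theorems.TaoLadderRungTwoBreakOneShiftBanach
import HarnessLib

/-!
# The admissible set of the one-shift map is non-empty: its centre point

The Banach fixed-point theorems `exists_surviving_dssWave_of_windowCert{,_rows,_v3,…,_v6}` carry the
hypothesis `h0 : ∃ u, F.AdmLip R u` (the complete invariant set is non-empty).  It is discharged here once and
for all: the CENTRE point — window coordinates `ỹ = 0`, flight-time coordinate `τ̃ = 0`, every tail trajectory
constant in time and equal to its tube centre (normalised coordinate `tubeC i k / wt k`), window-indexed tail
coordinates `0` — is admissible with time-Lipschitz constant `0`, hence lies in `AdmLip R` for every rate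
function `R` that is non-negative off the window (`exists_admLip`).  Model lattice only; nothing about
Navier–Stokes. [cite: Tao2016AveragedNS, §4, §5.3; cell vocabulary, harvest/h2-tao-ladder
rung1/KERNEL-STAGE3-PLAN.md §6 (hypothesis ledger, `h0`), rung1/INSTANCE-SHEET-T4-0.1-W76.md (row `h0`)]
-/

noncomputable section

namespace Summit.NavierStokesRegularity.NavierStokesRegularity.Theorems

namespace DSSOneShift

open Set
open Literature.Analysis.FluidPDE Literature.Analysis.FluidPDE.TaoCascade

variable {m : ℕ}

namespace OneShiftFrame

variable (F : OneShiftFrame m)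

/-- The bounded-metric constant of a frame is non-negative (`0 ≤ tubeR k ≤ B · wt k`, `wt k > 0`). [folklore] -/
theorem B_nonneg : 0 ≤ F.B := by
  by_contra h
  have h1 : F.B * F.wt 0 < 0 := mul_neg_of_neg_of_pos (lt_of_not_ge h) (F.wt_pos 0)
  have h2 : 0 ≤ F.B * F.wt 0 := (F.tubeR_nonneg 0).trans (F.tubeR_le 0)
  linarith

/-- The normalised tube-centre function `(i, k, t) ↦ tubeC i k / wt k` off the window (`0` on it) is bounded by
`B`, hence an `ℓ^∞` element. [folklore] -/
theorem centreFun_memℓp :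
    Memℓp (fun p : F.TailIdx => if F.InWindow p.2.1 then (0 : ℝ) else F.tubeC p.1 p.2.1 / F.wt p.2.1) ⊤ := by
  refine memℓp_infty ⟨F.B, ?_⟩
  rintro _ ⟨p, rfl⟩
  dsimp only
  rw [Real.norm_eq_abs]
  split_ifs with h
  · rw [abs_zero]; exact F.B_nonneg
  · rw [abs_div, abs_of_pos (F.wt_pos _), div_le_iff₀ (F.wt_pos _)]
    exact F.tubeC_le _ _

/-- **The admissible set is non-empty.**  The centre point (`ỹ = 0`, `τ̃ = 0`, tails constant `=` tube centres)
lies in `AdmLip R` for every rate function `R ≥ 0` off the window — this discharges the hypothesis `h0` of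
`exists_surviving_dssWave_of_windowCert{,_rows,_v3,_v4,_v5,_v6}` (for the four-shift bilinear rate function of
`v5/v6`, `0 ≤ R k` is `positivity`). [cite: Tao2016AveragedNS, §4, §5.3; cell vocabulary, harvest/h2-tao-ladder
rung1/KERNEL-STAGE3-PLAN.md §6] -/
theorem exists_admLip (R : ℤ → ℝ) (hR0 : ∀ k, ¬ F.InWindow k → 0 ≤ R k) : ∃ u, F.AdmLip R u := by
  refine ⟨((fun _ _ => 0), 0, ⟨_, F.centreFun_memℓp⟩), ?_⟩
  rw [admLip_iff]
  have hdec : ∀ i k t, F.decodeTail ((fun _ _ => 0), 0, ⟨_, F.centreFun_memℓp⟩) i k t =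
      F.wt k * (if F.InWindow k then 0 else F.tubeC i k / F.wt k) := fun i k t => rfl
  refine ⟨fun i k => by simp, by simp, fun i k hk t _ => ?_, fun i k hk t => ?_, fun i k hk s _ t _ => ?_⟩
  · rw [hdec, if_neg hk, mul_div_cancel₀ _ (F.wt_pos k).ne', sub_self, abs_zero]
    exact F.tubeR_nonneg k
  · show (if F.InWindow k then (0 : ℝ) else F.tubeC i k / F.wt k) = 0
    rw [if_pos hk]
  · rw [hdec, hdec, sub_self, abs_zero]
    exact mul_nonneg (hR0 k hk) (abs_nonneg _)

end OneShiftFrame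

end DSSOneShift

end Summit.NavierStokesRegularity.NavierStokesRegularity.Theorems
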